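import Mathlib
import Summits.MatrixMultiplication.MatrixMultiplication.Theses.GLnSeparatingDesigns
import Summits.MatrixMultiplication.MatrixMultiplication.Theorems.BorderHalfDimensionDesigns.Negative.AffineSubfamilyBounds

/-!
# Interpolation-scale lemma: a low-degree killer of a full affine digit grid kills the affine hull

Stub `stub_interpolation_scale` of line `Ideate5Sketch` (crux `BorderHalfDimensionDesigns`, item
stmt-MatrixMultiplication-18360, route `GLnSeparatingDesigns`; barrier note B12).

With full affine digit grids `x(a) = A₀ + Σ aᵢ Aᵢ`, `ζ(c) = C₀ + Σ cₖ Cₖ`, digits in `S^m`, `|S| = q`, a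
polynomial `F` of total degree `< q` in the `n²` entries that kills `x(a) · w · ζ(c)` on the grid kills it
for ALL complex `a, c`.  Proof: one block of digit variables at a time.  For fixed `c` the entries of
`x(a) · w · ζ(c)` are affine-linear forms in `a`, so `G(a) := F(entries)` is `MvPolynomial.bind₁` of
affine forms into `F`, of total degree `≤ totalDegree F < q` (`totalDegree_bind₁_le_of_affine`, tree),
hence of degree `< q = |S|` in each digit variable while vanishing on `S^m`; the combinatorial
Nullstellensatz (`MvPolynomial.eq_zero_of_eval_zero_at_prod_finset`) gives `G = 0`.  Then the same
argument in the `c`-digits for each fixed, now arbitrary, `a`.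
-/

set_option linter.dupNamespace false

open scoped BigOperators Matrix

namespace Summit.MatrixMultiplication.MatrixMultiplication.Theorems.BorderHalfDimensionDesigns

/-- **Affine grid interpolation.** If `f a = B₀ + Σᵢ aᵢ Bᵢ` coordinatewise (an affine-linear
parametrisation by `m` digits), `P` has total degree `< |S|`, and `P (f a) = 0` for all digit vectors
`a ∈ S^m`, then `P (f a) = 0` for every complex `a`: `P ∘ f` is a polynomial in the `m` digits of degree
`≤ totalDegree P < |S|` in each of them, so the combinatorial Nullstellensatz makes it zero. [folklore] -/
theorem eval_eq_zero_of_eval_eq_zero_on_affine_grid {ι : Type*} {m q : ℕ} (S : Finset ℂ)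
    (hS : S.card = q) (P : MvPolynomial ι ℂ) (hP : P.totalDegree < q) (f : (Fin m → ℂ) → ι → ℂ)
    (B₀ : ι → ℂ) (B : Fin m → ι → ℂ) (hf : ∀ a j, f a j = B₀ j + ∑ i, a i * B i j)
    (hkill : ∀ a : Fin m → ℂ, (∀ i, a i ∈ S) → MvPolynomial.eval (f a) P = 0) :
    ∀ a : Fin m → ℂ, MvPolynomial.eval (f a) P = 0 := by
  classical
  -- the affine-linear forms `B₀ j + Σ i, Xᵢ · B i j` in the digit variables `X₀, …, X_{m-1}`
  obtain ⟨ℓ, hℓ⟩ : ∃ ℓ : ι → MvPolynomial (Fin m) ℂ,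
      ℓ = fun j => MvPolynomial.C (B₀ j) + ∑ i, MvPolynomial.X i * MvPolynomial.C (B i j) :=
    ⟨_, rfl⟩
  have hℓdeg : ∀ j, (ℓ j).totalDegree ≤ 1 := by
    intro j
    simp only [hℓ]
    refine (MvPolynomial.totalDegree_add _ _).trans (max_le ?_ ?_)
    · rw [MvPolynomial.totalDegree_C]
      exact Nat.zero_le _
    · refine MvPolynomial.totalDegree_finsetSum_le fun i _ => ?_
      refine (MvPolynomial.totalDegree_mul _ _).trans ?_
      rw [MvPolynomial.totalDegree_C, MvPolynomial.totalDegree_X, add_zero]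
  -- `G := bind₁ ℓ P` computes `a ↦ P (f a)`
  have hGeval : ∀ a : Fin m → ℂ,
      MvPolynomial.eval a (MvPolynomial.bind₁ ℓ P) = MvPolynomial.eval (f a) P := by
    intro a
    have hfa : f a = fun j => MvPolynomial.eval a (ℓ j) := by
      funext j
      simp only [hf, hℓ, map_add, map_sum, map_mul, MvPolynomial.eval_C, MvPolynomial.eval_X]
    rw [hfa]
    exact MvPolynomial.eval₂Hom_bind₁ _ _ _ _
  -- its degree in each digit variable is `≤ totalDegree P < |S|`
  have hGdeg : ∀ i, (MvPolynomial.bind₁ ℓ P).degreeOf i < S.card := fun i =>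
    (MvPolynomial.degreeOf_le_totalDegree _ i).trans_lt
      ((BorderHalfDimensionDesignsNeg.totalDegree_bind₁_le_of_affine ℓ hℓdeg P).trans_lt
        (hP.trans_eq hS.symm))
  -- combinatorial Nullstellensatz on the grid `S^m`
  have hG0 : MvPolynomial.bind₁ ℓ P = 0 :=
    MvPolynomial.eq_zero_of_eval_zero_at_prod_finset (MvPolynomial.bind₁ ℓ P) (fun _ => S) hGdeg
      (fun x hx => by rw [hGeval]; exact hkill x hx)
  intro a
  rw [← hGeval, hG0, map_zero]

/-- **Interpolation-scale lemma** (barrier note B12): for affine digit parametrisations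
`x(a) = A₀ + Σ aᵢ Aᵢ`, `ζ(c) = C₀ + Σ cₖ Cₖ` with digits in a FULL grid `S^m`, `|S| = q`, a polynomial `F`
of total degree `< q` killing `x(a) · w · ζ(c)` on the grid kills it for all complex `a, c` (each entry is
affine in every single digit, so `F ∘ (x w ζ)` has degree `< q` in each variable: combinatorial
Nullstellensatz, applied first to the `a`-digits for every grid `c`, then to the `c`-digits). [folklore] -/
theorem stub_interpolation_scale {n m q : ℕ} (S : Finset ℂ) (hS : S.card = q)
    (A₀ C₀ : Matrix (Fin n) (Fin n) ℂ) (A C : Fin m → Matrix (Fin n) (Fin n) ℂ)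
    (w : Matrix (Fin n) (Fin n) ℂ) (F : MvPolynomial (Fin n × Fin n) ℂ) (hF : F.totalDegree < q)
    (hkill : ∀ a c : Fin m → ℂ, (∀ i, a i ∈ S) → (∀ k, c k ∈ S) →
      MvPolynomial.eval (fun ij : Fin n × Fin n =>
        ((A₀ + ∑ i, a i • A i) * w * (C₀ + ∑ k, c k • C k)) ij.1 ij.2) F = 0) :
    ∀ a c : Fin m → ℂ,
      MvPolynomial.eval (fun ij : Fin n × Fin n =>
        ((A₀ + ∑ i, a i • A i) * w * (C₀ + ∑ k, c k • C k)) ij.1 ij.2) F = 0 := by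
  -- entrywise affine expansions: in the `a`-digits for a fixed right factor `Z`, ...
  have hexpA : ∀ (Z : Matrix (Fin n) (Fin n) ℂ) (a : Fin m → ℂ) (ij : Fin n × Fin n),
      ((A₀ + ∑ i, a i • A i) * w * Z) ij.1 ij.2
        = (A₀ * w * Z) ij.1 ij.2 + ∑ i, a i * (A i * w * Z) ij.1 ij.2 := by
    intro Z a ij
    simp only [Matrix.add_mul, Matrix.sum_mul, Matrix.smul_mul, Matrix.add_apply, Matrix.sum_apply,
      Matrix.smul_apply, smul_eq_mul]
  -- ... and in the `c`-digits for a fixed left factor `M`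
  have hexpC : ∀ (M : Matrix (Fin n) (Fin n) ℂ) (c : Fin m → ℂ) (ij : Fin n × Fin n),
      (M * (C₀ + ∑ k, c k • C k)) ij.1 ij.2
        = (M * C₀) ij.1 ij.2 + ∑ k, c k * (M * C k) ij.1 ij.2 := by
    intro M c ij
    simp only [Matrix.mul_add, Matrix.mul_sum, Matrix.mul_smul, Matrix.add_apply, Matrix.sum_apply,
      Matrix.smul_apply, smul_eq_mul]
  -- step 1: free the `a`-digits for every grid vector `c`
  have h1 : ∀ c : Fin m → ℂ, (∀ k, c k ∈ S) → ∀ a : Fin m → ℂ,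
      MvPolynomial.eval (fun ij : Fin n × Fin n =>
        ((A₀ + ∑ i, a i • A i) * w * (C₀ + ∑ k, c k • C k)) ij.1 ij.2) F = 0 := by
    intro c hc
    exact eval_eq_zero_of_eval_eq_zero_on_affine_grid S hS F hF
      (fun a ij => ((A₀ + ∑ i, a i • A i) * w * (C₀ + ∑ k, c k • C k)) ij.1 ij.2)
      (fun ij => (A₀ * w * (C₀ + ∑ k, c k • C k)) ij.1 ij.2)
      (fun i ij => (A i * w * (C₀ + ∑ k, c k • C k)) ij.1 ij.2)
      (fun a ij => hexpA (C₀ + ∑ k, c k • C k) a ij) (fun a ha => hkill a c ha hc)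
  -- step 2: free the `c`-digits for every, now arbitrary, `a`
  intro a
  exact eval_eq_zero_of_eval_eq_zero_on_affine_grid S hS F hF
    (fun c ij => ((A₀ + ∑ i, a i • A i) * w * (C₀ + ∑ k, c k • C k)) ij.1 ij.2)
    (fun ij => ((A₀ + ∑ i, a i • A i) * w * C₀) ij.1 ij.2)
    (fun k ij => ((A₀ + ∑ i, a i • A i) * w * C k) ij.1 ij.2)
    (fun c ij => hexpC ((A₀ + ∑ i, a i • A i) * w) c ij) (fun c hc => h1 c hc a)

end Summit.MatrixMultiplication.MatrixMultiplication.Theorems.BorderHalfDimensionDesigns
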